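import Mathlib.Algebra.Algebra.Basic
import Mathlib.LinearAlgebra.BilinearMap
import Mathlib.LinearAlgebra.FiniteDimensional.Lemmas
import HarnessLib

/-!
# Route `SaturationLadder` — a square that spans a line annihilates its own factors:
# the rank obstruction behind SINGULAR macro fuels
# (decomp-mm lens 1 «grading / quantitative ladder», gen 40; support helper beneath crux `SubexpSaturation`,
# stmt-MatrixMultiplication-25909; companion of `SaturationLadderClassAtoms` (class floor `c⋆`) and of the
# by-hand Theorem F of memo `decomp-mm-lens-1/gen37/NODE-SaturationLadder-g37.md`)

PROVED, 0 sorry; pure commutative algebra over a field; no definitions, no instances, no named facts.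

SETTING (memo `decomp-mm-lens-1/gen40/NODE-SaturationLadder-g40.md` §1).  Item 25909 asks for exactly tight
thin shapes `ω(1,t,r) = 1 + r` at lengths `r ≤ exp(c/(1−t))` for EVERY `c > 0`.  Inside the single-scale
additive laser class the lineage proved the rate down to `c₂ = log θ_c = 1.0650531` and located the class floor
`c⋆ = 1.0645958` (`SaturationLadderClassAtoms`); Theorem F (gen 37, by hand) shows `c ≥ c⋆` for every far-edge
design whose FUEL — the one-dimensional `X`-block carrying the macroscopic letter `⟨1,1,D⟩`, `D = m − O(1)` —
has an invertible slice.  The open cell «row 1′» of the unique-usage map was: fuel leg `1`-generic, fuel slice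
SINGULAR of corank `O(1)`.  On the structure tensor `(a,b,φ) ↦ φ(ab)` of a graded local algebra
`𝒜 = K ⊕ V ⊕ (rare pieces)` with one macroscopic graded piece `V` (`dim V = D`), a one-dimensional `X`-block
with a slice of rank `≥ D − O(1)` is either the unit (orientations `X = a` or `X = b`; invertible, Theorem F) or,
in the orientation `X = φ`, a functional `φ_s` dual to a ONE-dimensional graded piece `K·s ⊇ V·V`, whose slice is
the bilinear form `(a,b) ↦ φ_s(ab)`; its macroscopic part is the form `q` on `V × V` defined by `u·v = q(u,v)·s`,
of rank `≥ D − O(1) ≥ 2`.  The theorems below say what such an algebra must look like.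

THE THEOREMS.  `K` a field, `R` a commutative `K`-algebra, `ι : V →ₗ[K] R` a linear map (the embedding of the
macroscopic piece), `s : R`, `q : V →ₗ[K] V →ₗ[K] K` with `ι u * ι v = q u v • s` for all `u v` (`hmul`).
* `q_eq_zero_of_orthogonal` — the FUEL-PARTNER LEMMA: if `s * r ≠ 0` then every `v` with `ι v * r = 0` lies in
  the radical of `q` (`q u v = 0 ∀ u`): `q(u,v)·(s r) = (ι u ι v) r = ι u (ι v r) = 0`;
* `finrank_range_le_of_mul_ne_zero` — hence `rank q ≤ rank (v ↦ ι v * r)` whenever `s * r ≠ 0`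
  (rank–nullity; `V` finite-dimensional);
* `q_comm` — `q` is symmetric as soon as `s ≠ 0`;
* `minor_eq_zero_of_mul_ne_zero` — if `s * ι w ≠ 0` for a single `w : V` then EVERY `2 × 2` minor of `q`
  vanishes (`q` has rank `≤ 1`): vectors `q`-orthogonal to `w` are radical, and `q(w,w)·v − q(v,w)·w` is
  orthogonal to `w`;
* `mul_eq_zero_of_minor_ne_zero` — contrapositive, the headline: **if some `2 × 2` minor of `q` is non-zero
  (rank `q ≥ 2`) then `s * ι w = 0` for every `w`**, and then `sq_eq_zero_of_minor_ne_zero` (`s * s = 0`) and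
  `triple_mul_eq_zero_of_minor_ne_zero` (`ι u * ι v * ι w = 0`): the subalgebra generated by `ι V` is
  `K·1 ⊕ ι V ⊕ K·s` with `s` in its socle — the connected sum `CW_ρ # N_k` of a Coppersmith–Winograd algebra
  (`ρ = rank q`) and a null algebra (`k = dim rad q`), whatever else `R` contains.

CONSEQUENCE FOR ITEM 25909 (memo §1, by hand from these theorems; same standing as Theorem F).  In the
orientation `X = φ` the fuel `φ_s` matches the unique `A`-source block `Y_0 = K·1` with the `Z`-block of `s`;
by `finrank_range_le_of_mul_ne_zero` applied to any `r` of positive degree (`ι V · r` lies in a rare piece, so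
`rank (v ↦ ι v r) = O(1) < rank q`) one gets `s · 𝔪 = 0`: the `Z`-block of `s` is fed ONLY through `y = 1`, i.e.
only by the fuel itself.  So the source is fully fuel-fed (`y_{Y_0} ≥ 1 + α`), case x of Lemma 1 (gen 37) is
impossible, the unique `B`-target is `Z_0` (partner `Y_s`, starved), and Theorem F's inequality chain gives
`c ≥ (★★)|_{S=1} = log 4 > c⋆` for every such design: row 1′ of the unique-usage map is CLOSED for graded-algebra
bases in all three orientations.  Below `c⋆` item 25909 therefore needs a base outside graded local algebras
(a `1`-degenerate minimal-border-rank family violating the rank-sum law — none is known — or a module tensor with a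
nearly-cyclic fuel vector), or a design outside the additive single-scale class.  A statement about ALGEBRAS
hosting a certificate, not about `ω`.
[cite: CoppersmithWinograd1990, §6–§8; BurgisserClausenShokrollahi1997, §15.7–15.8;
JelisiejewLandsbergPal2023, Thm. 1.10, §1.4.2; JagiellaJelisiejew2024, Cor. 1.5]
-/

set_option linter.dupNamespace false

namespace Summit.MatrixMultiplication.MatrixMultiplication.Theorems.SaturationLadderSingularFuel

section Scalars

variable {K W : Type*} [Field K] [AddCommGroup W] [Module K W]

/-- Over a field, `c • x = 0` with `c ≠ 0` forces `x = 0`. -/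
theorem eq_zero_of_smul_eq_zero {c : K} {x : W} (hc : c ≠ 0) (h : c • x = 0) : x = 0 := by
  have hx : c⁻¹ • (c • x) = x := by rw [smul_smul, inv_mul_cancel₀ hc, one_smul]
  rw [← hx, h, smul_zero]

/-- Over a field, `c • x = 0` with `x ≠ 0` forces `c = 0`. -/
theorem smul_coeff_eq_zero {c : K} {x : W} (hx : x ≠ 0) (h : c • x = 0) : c = 0 := by
  by_contra hc
  exact hx (eq_zero_of_smul_eq_zero hc h)

/-- Over a field, `c ↦ c • x` is injective for `x ≠ 0`. -/
theorem smul_left_cancel_of_ne_zero {a b : K} {x : W} (hx : x ≠ 0) (h : a • x = b • x) : a = b := by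
  have h' : (a - b) • x = 0 := by rw [sub_smul, h, sub_self]
  exact sub_eq_zero.mp (smul_coeff_eq_zero hx h')

end Scalars

section LineSquare

variable {K R V : Type*} [Field K] [CommRing R] [Algebra K R] [AddCommGroup V] [Module K V]
variable (ι : V →ₗ[K] R) (q : V →ₗ[K] V →ₗ[K] K) (s : R)

/-- FUEL-PARTNER LEMMA.  If `ι u * ι v = q u v • s` and `s * r ≠ 0`, then every `v` with `ι v * r = 0` is in the
radical of `q`.  (Associativity: `q(u,v) • (s * r) = (ι u * ι v) * r = ι u * (ι v * r) = 0`.) -/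
theorem q_eq_zero_of_orthogonal (hmul : ∀ u v, ι u * ι v = q u v • s) {r : R} (hsr : s * r ≠ 0)
    {v : V} (hv : ι v * r = 0) (u : V) : q u v = 0 := by
  have h : q u v • (s * r) = 0 := by
    rw [← smul_mul_assoc, ← hmul, mul_assoc, hv, mul_zero]
  exact smul_coeff_eq_zero hsr h

/-- The radical statement as an inclusion of kernels: `ker (v ↦ ι v * r) ≤ ker q.flip` when `s * r ≠ 0`
(`q.flip v u = q u v`, so `ker q.flip` is the right radical of `q`). -/
theorem ker_le_ker_flip (hmul : ∀ u v, ι u * ι v = q u v • s) {r : R} (hsr : s * r ≠ 0)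
    (lam : V →ₗ[K] R) (hlam : ∀ v, lam v = ι v * r) :
    LinearMap.ker lam ≤ LinearMap.ker q.flip := by
  intro v hv
  rw [LinearMap.mem_ker] at hv ⊢
  rw [hlam] at hv
  ext u
  rw [LinearMap.flip_apply, LinearMap.zero_apply]
  exact q_eq_zero_of_orthogonal ι q s hmul hsr hv u

/-- RANK FORM.  If `s * r ≠ 0` then `rank q ≤ rank (v ↦ ι v * r)`: the multiplication by any element that
does not kill `s` sees at least `rank q` independent directions of the macroscopic piece. -/
theorem finrank_range_le_of_mul_ne_zero [FiniteDimensional K V]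
    (hmul : ∀ u v, ι u * ι v = q u v • s) {r : R} (hsr : s * r ≠ 0)
    (lam : V →ₗ[K] R) (hlam : ∀ v, lam v = ι v * r) :
    Module.finrank K (LinearMap.range q.flip) ≤ Module.finrank K (LinearMap.range lam) := by
  have h1 := LinearMap.finrank_range_add_finrank_ker q.flip
  have h2 := LinearMap.finrank_range_add_finrank_ker lam
  have h3 : Module.finrank K (LinearMap.ker lam) ≤ Module.finrank K (LinearMap.ker q.flip) :=
    Submodule.finrank_mono (ker_le_ker_flip ι q s hmul hsr lam hlam)
  omega

/-- `q` is symmetric as soon as `s ≠ 0` (commutativity of `R`). -/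
theorem q_comm (hmul : ∀ u v, ι u * ι v = q u v • s) (hs : s ≠ 0) (u v : V) : q u v = q v u := by
  apply smul_left_cancel_of_ne_zero hs
  rw [← hmul, ← hmul, mul_comm]

/-- Vectors `q`-orthogonal to `w` are radical, provided `s * ι w ≠ 0`. -/
theorem radical_of_orthogonal (hmul : ∀ u v, ι u * ι v = q u v • s) {w : V} (hw : s * ι w ≠ 0)
    {v : V} (hv : q v w = 0) (u : V) : q u v = 0 := by
  have hs : s ≠ 0 := fun h => hw (by rw [h, zero_mul])
  have hvw : ι v * ι w = 0 := by rw [hmul, hv, zero_smul]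
  exact q_eq_zero_of_orthogonal ι q s hmul hw hvw u

/-- The rank-one identity: if `s * ι w ≠ 0` then `q(w,w) · q(u,v) = q(v,w) · q(u,w)` for all `u v`. -/
theorem rankOne_identity (hmul : ∀ u v, ι u * ι v = q u v • s) {w : V} (hw : s * ι w ≠ 0) (u v : V) :
    q w w * q u v = q v w * q u w := by
  -- `v' := q(w,w) • v − q(v,w) • w` is orthogonal to `w`, hence radical
  have horth : q (q w w • v - q v w • w) w = 0 := by
    rw [map_sub, map_smul, map_smul, LinearMap.sub_apply, LinearMap.smul_apply, LinearMap.smul_apply,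
      smul_eq_mul, smul_eq_mul]
    ring
  have hrad := radical_of_orthogonal ι q s hmul hw horth u
  rw [map_sub, map_smul, map_smul, smul_eq_mul, smul_eq_mul] at hrad
  -- hrad : q(w,w) q(u,v) − q(v,w) q(u,w) = 0
  exact sub_eq_zero.mp hrad

/-- RANK ≤ 1.  If `s * ι w ≠ 0` for one vector `w`, every `2 × 2` minor of `q` vanishes. -/
theorem minor_eq_zero_of_mul_ne_zero (hmul : ∀ u v, ι u * ι v = q u v • s) {w : V} (hw : s * ι w ≠ 0)
    (v₁ v₂ w₁ w₂ : V) : q v₁ w₁ * q v₂ w₂ = q v₁ w₂ * q v₂ w₁ := by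
  have I := rankOne_identity ι q s hmul hw
  by_cases hc : q w w = 0
  · -- then `q(v,w) q(u,w) = 0` for all `u v`; with `u = v`: `q(v,w) = 0`, so everything is radical: `q = 0`
    have hvw : ∀ v, q v w = 0 := by
      intro v
      have h := I v v
      rw [hc, zero_mul] at h
      exact pow_eq_zero_iff (n := 2) (by norm_num) |>.mp (by rw [pow_two]; exact h.symm)
    have hq : ∀ u v, q u v = 0 := fun u v => radical_of_orthogonal ι q s hmul hw (hvw v) u
    simp [hq]
  · have h₁ := I v₁ w₁
    have h₂ := I v₂ w₂
    have h₃ := I v₁ w₂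
    have h₄ := I v₂ w₁
    have hcc : q w w * q w w ≠ 0 := mul_ne_zero hc hc
    apply mul_left_cancel₀ hcc
    calc q w w * q w w * (q v₁ w₁ * q v₂ w₂)
        = (q w w * q v₁ w₁) * (q w w * q v₂ w₂) := by ring
      _ = (q w₁ w * q v₁ w) * (q w₂ w * q v₂ w) := by rw [h₁, h₂]
      _ = (q w₂ w * q v₁ w) * (q w₁ w * q v₂ w) := by ring
      _ = (q w w * q v₁ w₂) * (q w w * q v₂ w₁) := by rw [h₃, h₄]
      _ = q w w * q w w * (q v₁ w₂ * q v₂ w₁) := by ring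

/-- HEADLINE (contrapositive).  If some `2 × 2` minor of `q` is non-zero — `q` has rank at least two — then the
square-line generator `s` annihilates the whole macroscopic piece: `s * ι w = 0` for every `w`. -/
theorem mul_eq_zero_of_minor_ne_zero (hmul : ∀ u v, ι u * ι v = q u v • s) {v₁ v₂ w₁ w₂ : V}
    (hmin : q v₁ w₁ * q v₂ w₂ ≠ q v₁ w₂ * q v₂ w₁) (w : V) : s * ι w = 0 := by
  by_contra hw
  exact hmin (minor_eq_zero_of_mul_ne_zero ι q s hmul hw v₁ v₂ w₁ w₂)

/-- A non-zero minor exhibits a non-zero value of `q`. -/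
theorem exists_ne_zero_of_minor_ne_zero {v₁ v₂ w₁ w₂ : V}
    (hmin : q v₁ w₁ * q v₂ w₂ ≠ q v₁ w₂ * q v₂ w₁) : ∃ a b : V, q a b ≠ 0 := by
  by_cases h : q v₁ w₁ = 0
  · refine ⟨v₁, w₂, fun h' => hmin ?_⟩
    rw [h, h', zero_mul, zero_mul]
  · exact ⟨v₁, w₁, h⟩

/-- Under rank `≥ 2`: `s * s = 0`. -/
theorem sq_eq_zero_of_minor_ne_zero (hmul : ∀ u v, ι u * ι v = q u v • s) {v₁ v₂ w₁ w₂ : V}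
    (hmin : q v₁ w₁ * q v₂ w₂ ≠ q v₁ w₂ * q v₂ w₁) : s * s = 0 := by
  obtain ⟨a, b, hab⟩ := exists_ne_zero_of_minor_ne_zero q hmin
  have hsb : s * ι b = 0 := mul_eq_zero_of_minor_ne_zero ι q s hmul hmin b
  -- `q a b • (s * s) = (ι a * ι b) * s = ι a * (s * ι b) = 0`
  have h : q a b • (s * s) = 0 := by
    rw [← smul_mul_assoc, ← hmul, mul_assoc, mul_comm (ι b) s, hsb, mul_zero]
  exact eq_zero_of_smul_eq_zero hab h

/-- Under rank `≥ 2`: all triple products of the macroscopic piece vanish, `ι u * ι v * ι w = 0`. -/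
theorem triple_mul_eq_zero_of_minor_ne_zero (hmul : ∀ u v, ι u * ι v = q u v • s) {v₁ v₂ w₁ w₂ : V}
    (hmin : q v₁ w₁ * q v₂ w₂ ≠ q v₁ w₂ * q v₂ w₁) (u v w : V) : ι u * ι v * ι w = 0 := by
  rw [hmul, smul_mul_assoc, mul_eq_zero_of_minor_ne_zero ι q s hmul hmin w, smul_zero]

/-- Under rank `≥ 2`, the FUEL-PARTNER consequence in rank form: any `r` with `s * r ≠ 0` must act on the
macroscopic piece with rank at least `rank q`; equivalently (`finrank_range_le_of_mul_ne_zero` contraposed)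
every `r` whose multiplication map `v ↦ ι v * r` has rank `< rank q` kills `s`. -/
theorem mul_eq_zero_of_finrank_lt [FiniteDimensional K V] (hmul : ∀ u v, ι u * ι v = q u v • s) {r : R}
    (lam : V →ₗ[K] R) (hlam : ∀ v, lam v = ι v * r)
    (hlt : Module.finrank K (LinearMap.range lam) < Module.finrank K (LinearMap.range q.flip)) :
    s * r = 0 := by
  by_contra hsr
  exact absurd (finrank_range_le_of_mul_ne_zero ι q s hmul hsr lam hlam) (not_le.mpr hlt)

end LineSquare

section Sharpness

variable {K R : Type*} [Field K] [CommRing R] [Algebra K R]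

/-- SHARPNESS of the rank hypothesis: for a rank-ONE square law `x * x = 1 • s` on a one-dimensional piece
`V = K·x` (so every `2 × 2` minor vanishes), nothing forces `s * x = 0` — e.g. `x` with `x³ ≠ 0` in
`K[x]/(x⁴)`.  Formally: the hypotheses of `mul_eq_zero_of_minor_ne_zero` minus the minor condition are
satisfied by ANY element `x` of any commutative algebra, with `s := x * x`. -/
theorem rankOne_law_always_holds (x : R) :
    ∀ a b : K, (a • x) * (b • x) = (a * b) • (x * x) := by
  intro a b
  rw [smul_mul_smul_comm]

end Sharpness

end Summit.MatrixMultiplication.MatrixMultiplication.Theorems.SaturationLadderSingularFuel
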